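import Summits.BirchSwinnertonDyer.BirchSwinnertonDyer.Theorems.AdditiveKolyvaginRoadBottomRankOneAdditiveOfPrimitive
import Summits.BirchSwinnertonDyer.BirchSwinnertonDyer.Theorems.AdditiveKolyvaginRoadLevelRealisation
import Summits.BirchSwinnertonDyer.BirchSwinnertonDyer.Theorems.KolyvaginRoadThreePointCertificate
import Summits.BirchSwinnertonDyer.Rank1Residual.X11b.BDPRouteDescent
import Summits.BirchSwinnertonDyer.Rank1Residual.X11b.RingClassFieldNoTorsion
import Summits.BirchSwinnertonDyer.Rank1Residual.Additive.X4RankZeroLowerKolyvaginIndexForm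
import Literature.NumberTheory.EllipticCurves.KolyvaginShaStructureDivisibility
import Literature.NumberTheory.EllipticCurves.HeegnerPointFiniteIndex
import Literature.NumberTheory.EllipticCurves.BSDRootNumberSmallConductorProofs
import HarnessLib

/-!
# Route `AdditiveKolyvaginRoad`: KOLYVAGIN'S CONJECTURE MOD `p` (crux r2 KPA′ `KolyvaginPrimitiveAdditive`) FROM THE
# HEEGNER-INDEX LOWER BOUND — the route-level reading (R2′) of line `bdp_rebase` of crux KS′ `LevelKolyvaginSystemsAdditive`
# (item stmt-BirchSwinnertonDyer-21396), kernel-checked (cell `pub/bsd-wall`, width seat `bsd-wall-akr-p2x-w2` g5;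
# `--supports stmt-BirchSwinnertonDyer-21396`, helper)

THEOREMS ONLY (no definition, no named fact, no `sorry`); NOTHING about Kolyvagin's conjecture or about the Heegner-index lower
bound at an additive prime is asserted — both are HYPOTHESES ∕ CONCLUSIONS of implications.  BSD is not proved by any of this;
KS′, KPA′, BOT′ stay OPEN.

THE POINT (card `Cruxes/LevelKolyvaginSystemsAdditive/Lines/bdp-rebase.md` v3 §4, offer (R2′) «KPA′ WITHOUT LEVEL SYSTEMS», typed
in X11b's `hL` shape (b) as demanded by TRIAGE-r1-1 v13 — the ∃-over-all-parametrisations shape is refuted by scaling).  At a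
frame of the route (`W/ℚ` globally minimal, non-CM, `p ≥ 5` with `ρ̄_{E,p}` onto, `ord_{s=1} L(E,s) = 1`, `K` imaginary
quadratic with `d_K < −4`, the Heegner hypothesis for `N_E`, `L(E^{(d_K)},1) ≠ 0`, a frame `(Dt, β, ι)` with `4N ∣ β² − d_K`,
`p ∤ ∏ c_ℓ(E)`) suppose the HEEGNER-INDEX LOWER BOUND `X11b.IndexLowerBoundAt W p K P`
(`2·ord_p [E(K) : ℤP] ≤ ord_p #Ш(E/K) + 2·ord_p ∏ c_ℓ`) at the frame's Heegner points `P = y_K` (`P ↦ heegnerPointComplex Dt H`,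
`H.β = β`).  THEN some mod-`p` Kolyvagin class `c(n) ∈ H¹(K, E[p])` of Kolyvagin-prime support is NON-ZERO — the conclusion of
`KolyvaginPrimitiveAdditive` at the frame.  Proof (McCallum 1991 §5 read backwards):
* `y_K` is non-torsion (Gross–Zagier, `ord_{s=1} L(E/K,s) = 1`), `rank E(K) = 1`, `Ш(E/K)` finite (Kolyvagin), `E(K)[p] = 0`
  (`ρ̄` irreducible, `K` imaginary quadratic); `M₀ := ord_p [E(K) : ℤ y_K]` is the exact `p`-divisibility exponent of `y_K`
  (McCallum Lemma 5.1, tree `zsmul_certificate_of_padicValNat_index`);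
* LOWER BOUND + Kolyvagin's UPPER BOUND `ord_p #Ш ≤ 2 M₀` (`Kolyvagin1990_padicValNat_card_sha_le`) squeeze to the INDEX IDENTITY
  `ord_p #Ш(E/K) = 2 M₀` when `p ∤ ∏ c_ℓ` (`X11b.indexIdentityAt_of_lowerBound_of_kolyvagin`);
* McCallum's Cor. 5.6 in its DIVISIBILITY half (`McCallum1991_padicValNat_card_sha_primary_add_le_of_globalDivisibility`, `t = 1`):
  if EVERY derived point `P_n` at EVERY Kolyvagin level were `p`-divisible in `E(K[n])`, then `ord_p #Ш(E/K)[p^∞] + 2 ≤ 2 M₀` —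
  contradiction.  So some `P_n ∉ p·E(K[n])`, and McCallum's Cor. 4.5 with BOTH standing inputs supplied (admissibility of
  `E(K[n]) ⊆ E(K̄)` from `ρ̄` onto, Gross Lemma 4.3; `Γ_K`-invariance of `[P_n]` mod `p` from the Euler-system relations on a tower of
  data completed around the given datum, Gross Prop. 3.6 — tree `KolyCert.toGeomPoints_derivedPoint_mem_invPoints_of_dvd_zhang`)
  turns it into `c(n) ≠ 0`.
No reduction hypothesis at `p` is used: the frame theorem holds at ANY `p ≥ 5` with `ρ̄` onto (additive, good or multiplicative).

* §1 `exists_tower_eq_of_kolyvaginHeegnerData` — a datum at a square-free inert level is the top of a tower of data at all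
  divisors (Gross §3 data exist at every such level: `nonempty_kolyvaginHeegnerData_of_grossCM`, both CM inputs PROVED).
* §1 `kolyvaginClass_ne_zero_of_not_pDiv` — McCallum Cor. 4.5, hard direction, for ONE datum at a Kolyvagin level (`p ≥ 5` odd,
  `ρ̄` onto): `P_n ∉ p·E(K[n]) ⟹ c(n) ≠ 0`.
* §2 `exists_kolyvaginClass_ne_zero_of_indexLowerBoundAt` — ONE frame, the argument above.
* §3 `kolyvaginPrimitiveAdditive_of_indexLowerBound` — CLASS LEVEL against the route's decls:
  `PublishedInputsAdditiveKoly → (McCallum divisibility half) → ILBᵃᵈᵈ → KolyvaginPrimitiveAdditive`, where ILBᵃᵈᵈ is the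
  displayed hypothesis «at every ♯ additive frame (KPA′'s binders VERBATIM), `X11b.IndexLowerBoundAt W p K P` at the frame's Heegner
  points» — the statement `stub_indexLowerBoundAdditive` of line `bdp_rebase` in shape (b).  CONSEQUENCE for the pen (recorded,
  not acted on): granted PUB and McCallum's divisibility half, ILBᵃᵈᵈ ALONE feeds `closes` at `h₁ : KolyvaginPrimitiveAdditive`
  — without KS′ (21396), BOT′ (21397) or the E-side glue; ILBᵃᵈᵈ is BSD-true and is in print for `p ∤ N` (JSW 2017) and
  `p ∥ N` (Castella 2018 / Fouquet–Wan), OPEN at additive `p` (no printed Wan-direction divisibility at supercuspidal `p`).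

References (locators only): [cite: McCallumLMS1991, §1 Theorem (p. 296), §4 (4)–(6) and Cor. 4.5, §5 Lemma 5.1 and Cor. 5.6 (p. 310)]
[cite: GrossLMS1991, (1.1), Thm. 1.3, Prop. 3.6, Lemma 4.3, §4 (4.1)] [cite: KolyvaginEulerSystems1990, Thm. A]
[cite: JetchevSkinnerWan2017, §7.4.1 (eq:shalowerK-1), §7.4.3] [cite: Castella2018, (1.1)] [cite: WZhang2014, Thm. 1.1, §9]
[cite: SerreAbelianLadic1968, IV-23 Lemma 3] [cite: Darmon2004, Thm. 3.6–3.7].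
-/

-- single-conjunct summit: `Summit.BirchSwinnertonDyer.BirchSwinnertonDyer.…` repeats the name by design
set_option linter.dupNamespace false

set_option autoImplicit false

noncomputable section

open scoped Classical

namespace Summit.BirchSwinnertonDyer.BirchSwinnertonDyer.Theorems.AdditiveKoly

open WeierstrassCurve NumberField Field
  Literature.NumberTheory.EllipticCurves Literature.NumberTheory.EllipticCurves.ModularForms
  Literature.NumberTheory.EllipticCurves.Rank1Residual Literature.NumberTheory.EllipticCurves.KolyvaginCocycle
  Summit.BirchSwinnertonDyer.Rank1Residual Summit.BirchSwinnertonDyer.Rank1Residual.X11b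
  Summit.BirchSwinnertonDyer.Rank1Residual.X11b.Three
  Summit.BirchSwinnertonDyer.BirchSwinnertonDyer.Theses.AdditiveKolyvaginRoad

section Frame

-- `K : Type`: the tree's ring-class class field theory is universe `0` (as in the crux).
variable (W : WeierstrassCurve ℚ) [W.IsElliptic] [W.IsGloballyMinimal] [NeZero (W.conductorNorm ℤ)]
  (p : ℕ) [hp : Fact p.Prime] (K : Type) [Field K] [NumberField K]
  (Dt : ModularParametrizationData W (W.conductorNorm ℤ)) (β : ℤ) (ι : K →+* ℂ)

/-! ## §1 A datum is the top of a tower; McCallum's Cor. 4.5 (hard direction) for one datum -/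

omit [W.IsGloballyMinimal] hp in
/-- **A Kolyvagin–Heegner datum at a square-free inert level `n` is the top of a TOWER of data at all `m ∣ n`.**
Data at the lower levels exist by Gross 1991 §3 (`nonempty_kolyvaginHeegnerData_of_grossCM`, whose two CM inputs — `y(m) ∈ E(K[m])`
and the cyclicity of `Gal(K[m]/K[m/ℓ])` — are PROVED in the tree); at `m = n` the tower is the given datum.
[cite: GrossLMS1991, §3 (pp. 238–239) and §4 (4.1)] -/
theorem exists_tower_eq_of_kolyvaginHeegnerData (hK : IsImaginaryQuadratic K)
    (hH : SatisfiesHeegnerHypothesis (W.conductorNorm ℤ) K)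
    (hβ : (4 * (W.conductorNorm ℤ : ℤ)) ∣ β ^ 2 - NumberField.discr K) {n : ℕ} (hn : Squarefree n)
    (hinert : ∀ q ∈ n.primeFactors, (Ideal.span {(q : 𝓞 K)}).IsPrime) (d : KolyvaginHeegnerData Dt β ι n) :
    ∃ dT : (m : ℕ) → m ∣ n → KolyvaginHeegnerData Dt β ι m, dT n dvd_rfl = d := by
  have hne : ∀ m : ℕ, m ∣ n → Nonempty (KolyvaginHeegnerData Dt β ι m) := fun m hm ↦
    nonempty_kolyvaginHeegnerData_of_grossCM
      (phi_heegnerPointOfConductor_mem_range_map_ringClassField_holds (W.conductorNorm ℤ) W K)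
      exists_generator_ringClassGalOver_holds hK hH Dt β ι hβ (hn.squarefree_of_dvd hm)
      (fun q hq ↦ hinert q (Nat.primeFactors_mono hm hn.ne_zero hq))
  refine ⟨fun m hm ↦ if h : m = n then h ▸ d else (hne m hm).some, ?_⟩
  simp

/-- **McCallum's Cor. 4.5, hard direction, for ONE datum at a Kolyvagin level** (`p ≥ 5`, `ρ̄_{E,p}` onto, `K` imaginary
quadratic with `d_K < −4` and the Heegner hypothesis): if the derived point `P_n` of a Kolyvagin–Heegner datum `d` of square-free
conductor `n`, all of whose prime factors are Zhang–Kolyvagin primes, is NOT divisible by `p` in `E(K[n])`, then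
`c(n) = d.kolyvaginClass _ 1 ≠ 0`.  Admissibility of `E(K[n]) ⊆ E(K̄)` for `p` is Gross's Lemma 4.3 from `ρ̄` onto
(`RingClassNoTorsion.isAdmissible_pointsSubgroup`); `Γ_K`-invariance of `[P_n]` mod `p` is Gross's Prop. 3.6 on the tower of §1
(`KolyCert.toGeomPoints_derivedPoint_mem_invPoints_of_dvd_zhang`); then `KolyCert.kolyvaginClass_ne_zero_iff`.
[cite: McCallumLMS1991, §4 (4)–(5) and Cor. 4.5] [cite: GrossLMS1991, Prop. 3.6, Lemma 4.3, Prop. 4.7 (1)] -/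
theorem kolyvaginClass_ne_zero_of_not_pDiv (hp5 : 5 ≤ p) (hs : W.HasSurjectiveModNGaloisRep p)
    (hK : IsImaginaryQuadratic K) (hlt : NumberField.discr K < -4)
    (hH : SatisfiesHeegnerHypothesis (W.conductorNorm ℤ) K)
    (hβ : (4 * (W.conductorNorm ℤ : ℤ)) ∣ β ^ 2 - NumberField.discr K) {n : ℕ}
    (hn : KolyvaginDescent.KolSupp (Zhang2014.IsKolyvaginPrime (W.conductorNorm ℤ) W K p) n)
    (d : KolyvaginHeegnerData Dt β ι n) (hcert : ¬ Koly.PDiv d p 1) :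
    d.kolyvaginClass hp.out 1 ≠ 0 := by
  have hp2 : p ≠ 2 := by omega
  -- `(N, d_K) = 1` from the Heegner hypothesis
  have hND : IsCoprime (W.conductorNorm ℤ : ℤ) (NumberField.discr K) := by
    have h := Literature.SatisfiesHeegnerHypothesis.coprime_discr hK.1 hH
    refine Int.isCoprime_iff_gcd_eq_one.mpr ?_
    rw [Int.gcd_eq_natAbs, Int.natAbs_natCast]
    exact h
  have hkol : ∀ q ∈ n.primeFactors,
      Zhang2014.IsKolyvaginPrime (W.conductorNorm ℤ) W K p q ∧ 1 ≤ Zhang2014.kolyvaginIndex W p q :=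
    fun q hq ↦ ⟨hn.2 q hq, (hn.2 q hq).2.2.2.2.2⟩
  have hinert : ∀ q ∈ n.primeFactors, (Ideal.span {(q : 𝓞 K)}).IsPrime := fun q hq ↦ (hn.2 q hq).2.2.2.2.1
  -- complete `d` to a tower and read the invariance clause at the top
  obtain ⟨dT, hdT⟩ := exists_tower_eq_of_kolyvaginHeegnerData W K Dt β ι hK hH hβ hn.1 hinert d
  have hP := KolyCert.toGeomPoints_derivedPoint_mem_invPoints_of_dvd_zhang hK ι Dt hp.out hND hlt hn.1 hkol dT n dvd_rfl
  rw [hdT] at hP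
  have hA : IsAdmissible (absoluteGaloisGroup K) d.pointsSubgroup ((p ^ 1 : ℕ) : ℤ) :=
    RingClassNoTorsion.isAdmissible_pointsSubgroup d hK hn.1.ne_zero hp.out hp2 hs 1
  exact (KolyCert.kolyvaginClass_ne_zero_iff d hp.out 1).mpr ⟨hA, hP, hcert⟩

/-! ## §2 One frame: the Heegner-index lower bound forces a non-zero mod-`p` Kolyvagin class -/

/-- **KOLYVAGIN'S CONJECTURE MOD `p` FROM THE HEEGNER-INDEX LOWER BOUND (one frame).**  Data: `W/ℚ` globally minimal
elliptic, non-CM, `p ≥ 5` with `ρ̄_{E,p}` onto, `ord_{s=1} L(E,s) = 1`, `p ∤ ∏ c_ℓ(E)`; `K` imaginary quadratic with `d_K < −4`,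
the Heegner hypothesis for `N_E` and `L(E^{(d_K)},1) ≠ 0`; a frame `(Dt, β, ι)` with `4N_E ∣ β² − d_K`.  PUBLISHED inputs as
binders: Gross–Zagier `hGZ`, Kolyvagin `hKo` and his index bound `hKoB`, modularity `hmod`, McCallum's Cor. 5.6 DIVISIBILITY half
`hMc`.  HYPOTHESIS `hILB`: the Heegner-index lower bound `X11b.IndexLowerBoundAt W p K P` at every Heegner point `P ∈ E(K)` of the
frame (`P ↦ heegnerPointComplex Dt H`, `H.β = β`, `P` of infinite order).  CONCLUSION: some Kolyvagin–Heegner datum `d` at some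
Kolyvagin level `n` (square-free product of Zhang–Kolyvagin primes) has `d.kolyvaginClass _ 1 ≠ 0` in `H¹(K, E[p])`.
Proof: see the module docstring (index identity from ILB + Kolyvagin's bound; McCallum Cor. 5.6 divisibility half at `t = 1`
contradicts it unless some `P_n ∉ p·E(K[n])`; Cor. 4.5 with supplied standing inputs).  No reduction hypothesis at `p`.
CONDITIONAL on every binder; nothing is booked.
[cite: McCallumLMS1991, §1 Theorem (p. 296), §5 Lemma 5.1 and Cor. 5.6 (p. 310), §4 Cor. 4.5]
[cite: JetchevSkinnerWan2017, §7.4.3 (eq:shalower + eq:shaupper)] [cite: GrossLMS1991, (1.1), Thm. 1.3] -/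
theorem exists_kolyvaginClass_ne_zero_of_indexLowerBoundAt
    -- published inputs (named facts of the tree)
    (hGZ : gross_zagier (W.conductorNorm ℤ) W K) (hKo : kolyvagin (W.conductorNorm ℤ) W K)
    (hKoB : Kolyvagin1990_padicValNat_card_sha_le (W.conductorNorm ℤ) W K)
    (hmod : hasEntireLFunction_rat) (hMc : McCallum1991_padicValNat_card_sha_primary_add_le_of_globalDivisibility)
    -- the frame (only the binders that are used)
    (hp5 : 5 ≤ p) (hs : W.HasSurjectiveModNGaloisRep p) (hCM : ¬ W.HasCM) (hr : W.analyticRank = 1)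
    (htam : ¬ p ∣ W.tamagawaProduct)
    (hK : IsImaginaryQuadratic K) (hlt : NumberField.discr K < -4)
    (hH : SatisfiesHeegnerHypothesis (W.conductorNorm ℤ) K)
    (hL : (W.quadraticTwist (NumberField.discr K : ℚ)).entireLFunction 1 ≠ 0)
    (hβ : (4 * (W.conductorNorm ℤ : ℤ)) ∣ β ^ 2 - NumberField.discr K)
    -- the hypothesis: the Heegner-index lower bound at the frame's Heegner points
    (hILB : ∀ (H : HeegnerDatum (W.conductorNorm ℤ) (NumberField.discr K)) (P : (W.baseChange K).toAffine.Point),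
      H.β = β → WeierstrassCurve.Affine.Point.map ι.toRatAlgHom P = heegnerPointComplex Dt H → ¬ IsOfFinAddOrder P →
      X11b.IndexLowerBoundAt W p K P) :
    ∃ (n : ℕ) (d : KolyvaginHeegnerData Dt β ι n),
      KolyvaginDescent.KolSupp (Zhang2014.IsKolyvaginPrime (W.conductorNorm ℤ) W K p) n ∧
        d.kolyvaginClass hp.out 1 ≠ 0 := by
  have hpP : p.Prime := hp.out
  have hp2 : p ≠ 2 := by omega
  have hirr : W.HasIrreducibleModPGaloisRep p :=
    hasIrreducibleModPGaloisRep_of_hasSurjectiveModNGaloisRep W p hs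
  -- Serre: `ρ̄_{E,p}` onto at `p ≥ 5` lifts to the whole `p`-adic tower
  have hsurjT : ∀ m : ℕ, W.HasSurjectiveModNGaloisRep (p ^ m : ℕ) :=
    serre_hasSurjectiveModNGaloisRep_pow_holds W p hp5 hs
  have h3 : NumberField.discr K ≠ -3 := by omega
  have h4 : NumberField.discr K ≠ -4 := by omega
  have hDneg : NumberField.discr K < 0 := by omega
  -- an oriented Heegner datum `H` with `H.β = β` and THE Heegner point `P = y_K ∈ E(K)` (Darmon 3.6, proved)
  obtain ⟨H, hHβ⟩ := exists_heegnerDatum (W.conductorNorm ℤ) hDneg hβ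
  obtain ⟨P, hP⟩ := heegnerPointComplex_mem_range_map_holds (W.conductorNorm ℤ) W K hK hH Dt H ι
  have hHP : IsHeegnerPoint (W.conductorNorm ℤ) W K P := ⟨Dt, H, ι, hP⟩
  -- arithmetic of `E(K)`: `y_K` non-torsion (Gross–Zagier), rank one and `Ш(E/K)` finite (Kolyvagin), `E(K)[p] = 0`
  have hPinf : ¬ IsOfFinAddOrder P :=
    not_isOfFinAddOrder_of_heegner_of_analyticRank_eq_one W (W.conductorNorm ℤ) K Dt H ι P hGZ hmod hr hK hH hL hP
  obtain ⟨-, hSha⟩ := hKo hK hH hHP hPinf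
  haveI : Finite (W.baseChange K).sha := hSha
  have hA : ∀ a : (W.baseChange K).toAffine.Point, (p : ℤ) • a = 0 → a = 0 := by
    intro a ha
    have hmem : a ∈ AddSubgroup.torsionBy (W.baseChange K).toAffine.Point (p : ℤ) :=
      (KolyvaginCocycle.mem_torsionBy_iff' (p : ℤ) a).mpr ha
    rw [torsionBy_eq_bot_of_isImaginaryQuadratic_of_hasIrreducibleModPGaloisRep W K hK hpP hirr] at hmem
    exact (AddSubgroup.mem_bot).mp hmem
  -- the index `[E(K) : ℤ y_K]` is finite; `M₀ := ord_p` of it is the exact divisibility exponent of `y_K` (McCallum Lemma 5.1)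
  have hidx : (AddSubgroup.zmultiples P).index ≠ 0 :=
    index_zmultiples_ne_zero_of_isHeegnerPoint (W.conductorNorm ℤ) W K hKo hK hH hHP hPinf
  set M₀ : ℕ := padicValNat p (AddSubgroup.zmultiples P).index with hM₀
  obtain ⟨hdiv, hndiv⟩ := Additive.zsmul_certificate_of_padicValNat_index hpP hA hPinf hidx hM₀.symm
  -- LOWER BOUND (hypothesis) + Kolyvagin's UPPER BOUND ⟹ the index identity `ord_p #Ш(E/K) = 2 M₀` (as `p ∤ ∏ c_ℓ`)
  have hId : X11b.IndexIdentityAt W p K P :=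
    X11b.indexIdentityAt_of_lowerBound_of_kolyvagin W p hKoB hK hH hHP hPinf hp2 hs htam (hILB H P hHβ hP hPinf)
  have h0 : padicValNat p W.tamagawaProduct = 0 := padicValNat.eq_zero_of_not_dvd htam
  have hsha : padicValNat p (Nat.card (AddCommGroup.primaryComponent (W.baseChange K).sha p)) = 2 * M₀ := by
    rw [padicValNat_card_addPrimaryComponent (A := (W.baseChange K).sha) p]
    unfold X11b.IndexIdentityAt at hId
    rw [WeierstrassCurve.shaOrder, h0] at hId
    omega
  -- a conductor-`1` datum with `P(1) = y_K` in `E(K̄)` (Shimura reciprocity at conductor `1`, proved) — McCallum's `P`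
  obtain ⟨d₁⟩ := nonempty_kolyvaginHeegnerData_one W K Dt β ι hK hβ
  have hrec := heegnerPointOfConductor_one_galoisConj_holds (W.conductorNorm ℤ) W K
  have hPd : d₁.toGeomPoints d₁.derivedPoint = toGeomPoints (W.baseChange K) P :=
    KolyvaginBottom.toGeomPoints_derivedPoint_one_eq hrec hK hH hP d₁ hHβ
  -- McCallum Cor. 5.6, divisibility half at `t = 1`: if EVERY `P_n` were `p`-divisible then `ord_p #Ш[p^∞] + 2 ≤ 2 M₀` — absurd
  by_contra hnone
  have hglob : ∀ (s : ℕ), s ≤ 1 → ∀ (n : ℕ) (d : KolyvaginHeegnerData Dt β ι n), Squarefree n →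
      (∀ ℓ ∈ n.primeFactors, Zhang2014.IsKolyvaginPrime (W.conductorNorm ℤ) W K p ℓ ∧
        s ≤ Zhang2014.kolyvaginIndex W p ℓ) →
      ∃ Q : (W.baseChange (ringClassField K ι n)).toAffine.Point, ((p ^ s : ℕ) : ℤ) • Q = d.derivedPoint := by
    intro s hs1 n d hsq hkol
    rcases Nat.lt_or_ge s 1 with hs0 | hs1'
    · have : s = 0 := by omega
      subst this
      exact ⟨d.derivedPoint, by rw [pow_zero, Nat.cast_one, one_smul]⟩
    · have hs : s = 1 := le_antisymm hs1 hs1'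
      subst hs
      by_contra hnd
      have hsupp : KolyvaginDescent.KolSupp (Zhang2014.IsKolyvaginPrime (W.conductorNorm ℤ) W K p) n :=
        ⟨hsq, fun q hq ↦ (hkol q hq).1⟩
      exact hnone ⟨n, d, hsupp,
        kolyvaginClass_ne_zero_of_not_pDiv W p K Dt β ι hp5 hs hK hlt hH hβ hsupp d hnd⟩
  have hle := hMc W hCM K hK h3 h4 hH p hp2 hsurjT Dt β ι d₁ P hPd hPinf M₀ hdiv hndiv 1 hglob
  rw [hsha] at hle
  omega

end Frame

/-! ## §3 Class level, against the route's decls: `PUB → McCallum (divisibility) → ILBᵃᵈᵈ → KPA′` -/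

/-- **CRUX r2 `KolyvaginPrimitiveAdditive` FROM THE HEEGNER-INDEX LOWER BOUND AT ADDITIVE `p` (ILBᵃᵈᵈ), modulo the route's
published inputs and McCallum's Cor. 5.6 (divisibility half).**  ILBᵃᵈᵈ is displayed as the hypothesis `hILB`: at every ♯
additive frame — the binders of `KolyvaginPrimitiveAdditive` VERBATIM — the Heegner-index lower bound `X11b.IndexLowerBoundAt W p K P`
holds at the frame's Heegner points (`P ↦ heegnerPointComplex Dt H`, `H.β = β`, `P` of infinite order); this is line `bdp_rebase`'s
`stub_indexLowerBoundAdditive` in X11b's `hL` shape (STEP L of Jetchev–Skinner–Wan ∕ Castella at an additive prime; BSD-true;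
in print only for `p ∤ N` and `p ∥ N`).  Of `PublishedInputsAdditiveKoly` only Gross–Zagier, Kolyvagin, Kolyvagin's index bound and
modularity are used; `¬CM` comes from a multiplicative prime (♠(2)).  CONSEQUENCE (route-level reading, recorded not acted on):
granted PUB and McCallum's divisibility half, ILBᵃᵈᵈ alone yields `h₁ : KolyvaginPrimitiveAdditive` of `closes`, with no level
Kolyvagin systems (KS′), no bottom crux (BOT′) and no E-side glue.  CONDITIONAL on all three antecedents; nothing is booked.
[cite: McCallumLMS1991, §5 Cor. 5.6 (p. 310), Lemma 5.1, §4 Cor. 4.5] [cite: JetchevSkinnerWan2017, §7.4.1 (eq:shalowerK-1)]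
[cite: Castella2018, (1.1)] [cite: WZhang2014, Thm. 1.1] -/
theorem kolyvaginPrimitiveAdditive_of_indexLowerBound (hPub : PublishedInputsAdditiveKoly)
    (hMc : McCallum1991_padicValNat_card_sha_primary_add_le_of_globalDivisibility)
    (hILB : ∀ (W : WeierstrassCurve ℚ) [W.IsElliptic] [W.IsGloballyMinimal] [NeZero (W.conductorNorm ℤ)]
      (p : ℕ) [Fact p.Prime] (K : Type) [Field K] [NumberField K]
      (Dt : ModularParametrizationData W (W.conductorNorm ℤ)) (β : ℤ) (ι : K →+* ℂ),
      5 ≤ p → Addv W p → W.HasSurjectiveModNGaloisRep p →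
      (∀ (ℓ : ℕ) [Fact ℓ.Prime], W.HasMultiplicativeReductionAtPrime ℓ → ¬ p ∣ padicValInt ℓ W.minimalDiscriminantInt) →
      (∃ (ℓ₁ ℓ₂ : ℕ) (_ : Fact ℓ₁.Prime) (_ : Fact ℓ₂.Prime), ℓ₁ ≠ ℓ₂ ∧
        W.HasMultiplicativeReductionAtPrime ℓ₁ ∧ W.HasMultiplicativeReductionAtPrime ℓ₂) →
      ¬ p ∣ W.tamagawaProduct → W.analyticRank = 1 → IsImaginaryQuadratic K → Odd (NumberField.discr K) →
      NumberField.discr K < -4 → SatisfiesHeegnerHypothesis (W.conductorNorm ℤ) K →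
      (W.quadraticTwist (NumberField.discr K : ℚ)).entireLFunction 1 ≠ 0 →
      (4 * (W.conductorNorm ℤ : ℤ)) ∣ β ^ 2 - NumberField.discr K → ¬ (p : ℤ) ∣ Dt.c →
      ∀ (H : HeegnerDatum (W.conductorNorm ℤ) (NumberField.discr K)) (P : (W.baseChange K).toAffine.Point),
        H.β = β → WeierstrassCurve.Affine.Point.map ι.toRatAlgHom P = heegnerPointComplex Dt H → ¬ IsOfFinAddOrder P →
        X11b.IndexLowerBoundAt W p K P) :
    KolyvaginPrimitiveAdditive := by
  intro W _ _ _ p _ K _ _ Dt β ι hp5 hadd hs hsp htwo htam hr hK hodd hlt hH hL hβ hc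
  obtain ⟨hGZ, hKo, hKoB, -, hmod, -⟩ := hPub
  -- non-CM from a multiplicative prime
  obtain ⟨ℓ₁, ℓ₂, hℓ₁, hℓ₂, hne, hm₁, hm₂⟩ := htwo
  have hCM : ¬ W.HasCM := not_hasCM_of_hasMultiplicativeReductionAtPrime' W hm₁
  exact exists_kolyvaginClass_ne_zero_of_indexLowerBoundAt W p K Dt β ι (hGZ _ W K) (hKo _ W K) (hKoB _ W K) hmod hMc
    hp5 hs hCM hr htam hK hlt hH hL hβ
    (hILB W p K Dt β ι hp5 hadd hs hsp ⟨ℓ₁, ℓ₂, hℓ₁, hℓ₂, hne, hm₁, hm₂⟩ htam hr hK hodd hlt hH hL hβ hc)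

end Summit.BirchSwinnertonDyer.BirchSwinnertonDyer.Theorems.AdditiveKoly

end
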